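import Summits.QuantumFields.YangMills.Theorems.ColdStartUniversalityLatticeLangevinLezaudMeasurable
import Summits.QuantumFields.YangMills.Theorems.ColdStartUniversalityLatticeLangevinErgodicAverageEveryRealisation
import HarnessLib

/-!
# Route `ColdStartUniversality` (fixed-cut-off SZZ dynamics, sampler statistics): ★★★ LEZAUD'S BERNSTEIN INEQUALITY FOR TIME AVERAGES OF
# ALL BOUNDED MEASURABLE OBSERVABLES AND FOR OCCUPATION TIMES — every realisation, volume-free after the `O(log L)` burn-in, `|β'| < 1/12`

Helper file (seat `ym-line-csu-p1`, g37; `--supports stmt-QuantumFields-24809`).  SU(2) lattice Langevin dynamics of Shen–Zhu–Zhu at `(L, β')`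
with `|β'| < 1/12` (`λ = 1 − 12|β'|`), Wilson measure `μ = μ_{β'}`, burn-in `a = 2 + t₀ + u` with `log B ≤ 2λt₀` (`B = O(L³)`, `t₀ = O(log L)`).
`…LezaudMeasurable` proves the exponential-moment bound for jointly measurable solutions; a jointly measurable solution exists on every space
(g33, `LiebRobinson.exists_flow_measurable_uncurry`) and strong solutions are pathwise unique (`latticeLangevin_pathwise_unique`), so:

* ★★★ `coldStart_integral_exp_timeIntegral_le_uniform_of_measurable_of_solution` — for EVERY strong solution `U` from a deterministic start on
  ANY filtered probability space, EVERY measurable `G` with `|G| ≤ 1`, `Var_μ(G) ≤ σ²`, `0 ≤ θ`, `2θ < λ`, `T > 0`: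
  `E exp(θ(∫_{(0,T]} G(U_{2+t₀+u+r})dr − TμG)) ≤ e·exp(Tθ²σ²/(λ − 2θ))`;
* ★★★ `coldStart_timeAverage_tail_le_bernstein_uniform_of_measurable` — `P[T⁻¹∫_{(0,T]} G(U_{2+t₀+u+r})dr − μG ≥ ε] ≤ e·exp(−λTε²/(4σ² + 4ε))`;
* ★★★ `coldStart_timeAverage_deviation_le_bernstein_uniform_of_measurable` — two-sided: `≤ 2e·exp(−λTε²/(4σ² + 4ε))`;
* ★★★ `coldStart_occupationTime_deviation_le_uniform` — OCCUPATION TIMES: for every measurable set `A` of configurations with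
  `μ_{β'}(A)(1 − μ_{β'}(A)) ≤ σ²`:  `P[ |T⁻¹∫_{(0,T]} 𝟙_A(U_{2+t₀+u+r}) dr − μ_{β'}(A)| ≥ ε ] ≤ 2e·exp(−λTε²/(4σ² + 4ε))` — the fraction of time
  the cold-start sampler spends in `A` after the burn-in concentrates exponentially at the Gibbs probability of `A`, with constants independent
  of `L` (Lezaud's occupation-measure Chernoff bound).
[cite: Lezaud2001, Theorem 1.1 and Remark 1.2] [cite: DiaconisSaloffcoste1996, Theorem 3.7].  THEOREMS ONLY, no definition, no sorry.  HONEST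
FRAMING: RECORD-rung R3 plumbing at FIXED cut-off in LATTICE units; "volume-free" refers to `L` at fixed `|β'| < 1/12` (high temperature);
the route's scaling `β'_K → ∞` leaves the window; `UniformColdStartMixing` (24809) is NOT restated; nothing K-uniform is proved; no crux, rung
or summit statement is proved; the Yang–Mills mass gap is NOT proved.
-/

set_option autoImplicit false

noncomputable section

namespace Summit.QuantumFields.YangMills.Theorems.ColdStartUniversality

open MeasureTheory ProbabilityTheory Filter Set Topology
open scoped BigOperators NNReal ENNReal
open Literature.Probability.Process Literature.MathematicalPhysics.QuantumFieldTheory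
open Literature.MathematicalPhysics.QuantumLattice (fundamentalRep fundamentalLatticeRep continuous_fundamentalRep)

variable {L : ℕ} [NeZero L]

/-! ## §1. Every realisation -/

/-- ★★★ **LEZAUD'S EXPONENTIAL MOMENT BOUND FOR ALL BOUNDED MEASURABLE OBSERVABLES, EVERY REALISATION, `|β'| < 1/12`.**  For every `L`,
`|β'| < 1/12` (`λ := 1 − 12|β'|`), every deterministic start `z`, EVERY strong solution `U` from `z` on ANY filtered probability space, EVERY
measurable `G` with `|G| ≤ 1` and `Var_{μ_{β'}}(G) ≤ σ²`, every `0 ≤ θ` with `2θ < λ`, all `t₀, u` with `log B ≤ 2λt₀`, `T > 0`: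
the functional is integrable and `∫ exp(θ(∫_{(0,T]} G(U_{2+t₀+u+r}) dr − T·μ_{β'}G)) dP ≤ e · exp(T·θ²σ²/(λ − 2θ))`
(the jointly measurable flow of g33 and pathwise uniqueness). [cite: Lezaud2001, Theorem 1.1 and Remark 1.2] -/
theorem coldStart_integral_exp_timeIntegral_le_uniform_of_measurable_of_solution (L : ℕ) [NeZero L] (β' : ℝ) (hβ : |β'| < 1 / 12)
    (z : GaugeConfig 3 L (Matrix.specialUnitaryGroup (Fin 2) ℂ))
    {Ω : Type} [MeasurableSpace Ω] {P : Measure Ω} [IsProbabilityMeasure P]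
    {W : ℝ≥0 → Ω → (Edge 3 L × NoiseIdx 2 → ℝ)} (hW : IsFlatBrownian W P)
    {U : ℝ≥0 → Ω → GaugeConfig 3 L (Matrix.specialUnitaryGroup (Fin 2) ℂ)} (hU0 : ∀ ω, U 0 ω = z)
    (hU : (latticeLangevinDynamics (fundamentalLatticeRep 2) β').IsSolution (fundamentalRep (Fin 2)) hW.natFiltration P W U)
    {G : GaugeConfig 3 L (Matrix.specialUnitaryGroup (Fin 2) ℂ) → ℝ} (hG : Measurable G) (hG1 : ∀ x, |G x| ≤ 1) {σ : ℝ}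
    (hσ2 : ∫ x, (G x - ∫ y, G y ∂(wilsonMeasure (d := 3) (L := L) (fundamentalRep (Fin 2)) β')) ^ 2 ∂(wilsonMeasure (d := 3) (L := L) (fundamentalRep (Fin 2)) β') ≤ σ ^ 2)
    {θ : ℝ} (hθ : 0 ≤ θ) (hθ2 : θ * 2 < 1 - 12 * |β'|) (t₀ u : ℝ≥0)
    (ht₀ : Real.log (96 * |β'| * (Fintype.card (Edge 3 L) : ℝ) + 10 * |β'| * (Fintype.card (Plaquette 3 L) : ℝ) + Real.log 2 +
      (Fintype.card (Edge 3 L) : ℝ) * Real.log (3 / 2)) ≤ 2 * (1 - 12 * |β'|) * t₀)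
    {T : ℝ} (hT : 0 < T) :
    Integrable (fun ω => Real.exp (θ * ((∫ r in Ioc 0 T, G (U (2 + t₀ + u + r.toNNReal) ω)) - T * ∫ y, G y ∂(wilsonMeasure (d := 3) (L := L) (fundamentalRep (Fin 2)) β')))) P ∧
    ∫ ω, Real.exp (θ * ((∫ r in Ioc 0 T, G (U (2 + t₀ + u + r.toNNReal) ω)) - T * ∫ y, G y ∂(wilsonMeasure (d := 3) (L := L) (fundamentalRep (Fin 2)) β'))) ∂P ≤
      Real.exp 1 * Real.exp (T * (θ ^ 2 * σ ^ 2 / ((1 - 12 * |β'|) - θ * 2))) := by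
  obtain ⟨V, hV⟩ := LiebRobinson.exists_flow_measurable_uncurry L β' hW
  obtain ⟨hint, hle⟩ := coldStart_integral_exp_timeIntegral_le_uniform_of_measurable L β' hβ z hW (hV z).1 (hV z).2.1 (hV z).2.2 hG hG1
    hσ2 hθ hθ2 t₀ u ht₀ hT
  have hae := latticeLangevin_pathwise_unique hW β' z hU0 (hV z).1 hU (hV z).2.1
  have heq : (fun ω => Real.exp (θ * ((∫ r in Ioc 0 T, G (U (2 + t₀ + u + r.toNNReal) ω)) - T * ∫ y, G y ∂(wilsonMeasure (d := 3) (L := L) (fundamentalRep (Fin 2)) β')))) =ᵐ[P]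
      fun ω => Real.exp (θ * ((∫ r in Ioc 0 T, G (V z (2 + t₀ + u + r.toNNReal) ω)) - T * ∫ y, G y ∂(wilsonMeasure (d := 3) (L := L) (fundamentalRep (Fin 2)) β'))) := by
    filter_upwards [hae] with ω hω
    have hfun : (fun r : ℝ => G (U (2 + t₀ + u + r.toNNReal) ω)) = fun r : ℝ => G (V z (2 + t₀ + u + r.toNNReal) ω) :=
      funext fun r => by rw [hω]
    simp only [hfun]
  exact ⟨hint.congr heq.symm, (integral_congr_ae heq).trans_le hle⟩

/-! ## §2. Bernstein tails for all bounded measurable observables -/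

/-- ★★★ **LEZAUD'S BERNSTEIN INEQUALITY FOR TIME AVERAGES OF ALL BOUNDED MEASURABLE OBSERVABLES — VOLUME-FREE after the `O(log L)`
burn-in, `|β'| < 1/12`, every realisation.**  For every `L`, `|β'| < 1/12` (`λ := 1 − 12|β'|`), every deterministic start `z`, EVERY strong
solution `U` from `z` on ANY filtered probability space, EVERY measurable `G` with `|G| ≤ 1` and `Var_{μ_{β'}}(G) ≤ σ²` (`σ > 0`), all
`t₀, u` with `log B ≤ 2λt₀`, every `T > 0` and `ε > 0`:

  `P[ T⁻¹ ∫_{(0,T]} G(U_{2+t₀+u+r}) dr − ∫ G dμ_{β'} ≥ ε ] ≤ e · exp(−λ·T·ε² / (4σ² + 4ε))`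

(Markov's inequality on the exponential moment at `θ = λε/(2σ² + 2ε)`).  No constant depends on `L`.
[cite: Lezaud2001, Theorem 1.1 and Remark 1.2] [cite: DiaconisSaloffcoste1996, Theorem 3.7] -/
theorem coldStart_timeAverage_tail_le_bernstein_uniform_of_measurable (L : ℕ) [NeZero L] (β' : ℝ) (hβ : |β'| < 1 / 12)
    (z : GaugeConfig 3 L (Matrix.specialUnitaryGroup (Fin 2) ℂ))
    {Ω : Type} [MeasurableSpace Ω] {P : Measure Ω} [IsProbabilityMeasure P]
    {W : ℝ≥0 → Ω → (Edge 3 L × NoiseIdx 2 → ℝ)} (hW : IsFlatBrownian W P)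
    {U : ℝ≥0 → Ω → GaugeConfig 3 L (Matrix.specialUnitaryGroup (Fin 2) ℂ)} (hU0 : ∀ ω, U 0 ω = z)
    (hU : (latticeLangevinDynamics (fundamentalLatticeRep 2) β').IsSolution (fundamentalRep (Fin 2)) hW.natFiltration P W U)
    {G : GaugeConfig 3 L (Matrix.specialUnitaryGroup (Fin 2) ℂ) → ℝ} (hG : Measurable G) (hG1 : ∀ x, |G x| ≤ 1) {σ : ℝ} (hσ : 0 < σ)
    (hσ2 : ∫ x, (G x - ∫ y, G y ∂(wilsonMeasure (d := 3) (L := L) (fundamentalRep (Fin 2)) β')) ^ 2 ∂(wilsonMeasure (d := 3) (L := L) (fundamentalRep (Fin 2)) β') ≤ σ ^ 2)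
    (t₀ u : ℝ≥0)
    (ht₀ : Real.log (96 * |β'| * (Fintype.card (Edge 3 L) : ℝ) + 10 * |β'| * (Fintype.card (Plaquette 3 L) : ℝ) + Real.log 2 +
      (Fintype.card (Edge 3 L) : ℝ) * Real.log (3 / 2)) ≤ 2 * (1 - 12 * |β'|) * t₀)
    {T : ℝ} (hT : 0 < T) {ε : ℝ} (hε : 0 < ε) :
    P.real {ω | ε ≤ T⁻¹ * (∫ r in Ioc 0 T, G (U (2 + t₀ + u + r.toNNReal) ω)) - ∫ y, G y ∂(wilsonMeasure (d := 3) (L := L) (fundamentalRep (Fin 2)) β')} ≤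
      Real.exp 1 * Real.exp (-((1 - 12 * |β'|) * T * ε ^ 2 / (4 * σ ^ 2 + 4 * ε))) := by
  classical
  set lam : ℝ := 1 - 12 * |β'| with hlamdef
  have hlam : 0 < lam := by rw [hlamdef]; linarith
  set m : ℝ := ∫ y, G y ∂(wilsonMeasure (d := 3) (L := L) (fundamentalRep (Fin 2)) β') with hm
  obtain ⟨hθ, hθb, hexp⟩ := lezaud_bernstein_exponent (T := T) (b := 2) hlam (by norm_num) hσ hε
  set θ : ℝ := lam * ε / (2 * σ ^ 2 + 2 * ε) with hθdef
  have hθ2 : θ * 2 < lam := hθb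
  obtain ⟨hFl_int, hmgf⟩ := coldStart_integral_exp_timeIntegral_le_uniform_of_measurable_of_solution L β' hβ z hW hU0 hU hG hG1 hσ2 hθ
    hθ2 t₀ u ht₀ hT
  rw [← hm] at hmgf hFl_int
  set Fl : Ω → ℝ := fun ω => Real.exp (θ * ((∫ r in Ioc 0 T, G (U (2 + t₀ + u + r.toNNReal) ω)) - T * m)) with hFldef
  have hsub : {ω | ε ≤ T⁻¹ * (∫ r in Ioc 0 T, G (U (2 + t₀ + u + r.toNNReal) ω)) - m} ⊆ {ω | Real.exp (θ * T * ε) ≤ Fl ω} := by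
    intro ω hω
    simp only [Set.mem_setOf_eq] at hω ⊢
    rw [hFldef]
    refine Real.exp_le_exp.2 ?_
    have h1 : T * ε ≤ (∫ r in Ioc 0 T, G (U (2 + t₀ + u + r.toNNReal) ω)) - T * m := by
      have := mul_le_mul_of_nonneg_left hω hT.le
      rwa [mul_sub, ← mul_assoc, mul_inv_cancel₀ hT.ne', one_mul] at this
    calc θ * T * ε = θ * (T * ε) := by ring
      _ ≤ θ * ((∫ r in Ioc 0 T, G (U (2 + t₀ + u + r.toNNReal) ω)) - T * m) := mul_le_mul_of_nonneg_left h1 hθ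
  have hmarkov := mul_meas_ge_le_integral_of_nonneg (μ := P) (ae_of_all _ fun ω => (Real.exp_pos _).le) hFl_int (Real.exp (θ * T * ε))
  have hexp0 : 0 < Real.exp (θ * T * ε) := Real.exp_pos _
  calc P.real {ω | ε ≤ T⁻¹ * (∫ r in Ioc 0 T, G (U (2 + t₀ + u + r.toNNReal) ω)) - m}
      ≤ P.real {ω | Real.exp (θ * T * ε) ≤ Fl ω} := measureReal_mono hsub
    _ ≤ (∫ ω, Fl ω ∂P) / Real.exp (θ * T * ε) := by rw [le_div_iff₀ hexp0, mul_comm]; exact hmarkov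
    _ ≤ Real.exp 1 * Real.exp (T * (θ ^ 2 * σ ^ 2 / (lam - θ * 2))) / Real.exp (θ * T * ε) :=
        div_le_div_of_nonneg_right hmgf hexp0.le
    _ = Real.exp 1 * Real.exp (T * (θ ^ 2 * σ ^ 2 / (lam - θ * 2)) - θ * T * ε) := by
        rw [mul_div_assoc, ← Real.exp_sub]
    _ = Real.exp 1 * Real.exp (-(lam * T * ε ^ 2 / (4 * σ ^ 2 + 2 * 2 * ε))) := by rw [hexp]
    _ = Real.exp 1 * Real.exp (-(lam * T * ε ^ 2 / (4 * σ ^ 2 + 4 * ε))) := by norm_num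

/-- ★★★ **TWO-SIDED VOLUME-FREE BERNSTEIN INEQUALITY for time averages of ALL bounded measurable observables, every realisation,
`|β'| < 1/12`.**  In the setting of `coldStart_timeAverage_tail_le_bernstein_uniform_of_measurable`:

  `P[ |T⁻¹ ∫_{(0,T]} G(U_{2+t₀+u+r}) dr − ∫ G dμ_{β'}| ≥ ε ] ≤ 2e · exp(−(1 − 12|β'|)·T·ε² / (4σ² + 4ε))`.

[cite: Lezaud2001, Theorem 1.1 and Remark 1.2] -/
theorem coldStart_timeAverage_deviation_le_bernstein_uniform_of_measurable (L : ℕ) [NeZero L] (β' : ℝ) (hβ : |β'| < 1 / 12)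
    (z : GaugeConfig 3 L (Matrix.specialUnitaryGroup (Fin 2) ℂ))
    {Ω : Type} [MeasurableSpace Ω] {P : Measure Ω} [IsProbabilityMeasure P]
    {W : ℝ≥0 → Ω → (Edge 3 L × NoiseIdx 2 → ℝ)} (hW : IsFlatBrownian W P)
    {U : ℝ≥0 → Ω → GaugeConfig 3 L (Matrix.specialUnitaryGroup (Fin 2) ℂ)} (hU0 : ∀ ω, U 0 ω = z)
    (hU : (latticeLangevinDynamics (fundamentalLatticeRep 2) β').IsSolution (fundamentalRep (Fin 2)) hW.natFiltration P W U)
    {G : GaugeConfig 3 L (Matrix.specialUnitaryGroup (Fin 2) ℂ) → ℝ} (hG : Measurable G) (hG1 : ∀ x, |G x| ≤ 1) {σ : ℝ} (hσ : 0 < σ)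
    (hσ2 : ∫ x, (G x - ∫ y, G y ∂(wilsonMeasure (d := 3) (L := L) (fundamentalRep (Fin 2)) β')) ^ 2 ∂(wilsonMeasure (d := 3) (L := L) (fundamentalRep (Fin 2)) β') ≤ σ ^ 2)
    (t₀ u : ℝ≥0)
    (ht₀ : Real.log (96 * |β'| * (Fintype.card (Edge 3 L) : ℝ) + 10 * |β'| * (Fintype.card (Plaquette 3 L) : ℝ) + Real.log 2 +
      (Fintype.card (Edge 3 L) : ℝ) * Real.log (3 / 2)) ≤ 2 * (1 - 12 * |β'|) * t₀)
    {T : ℝ} (hT : 0 < T) {ε : ℝ} (hε : 0 < ε) :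
    P.real {ω | ε ≤ |T⁻¹ * (∫ r in Ioc 0 T, G (U (2 + t₀ + u + r.toNNReal) ω)) - ∫ y, G y ∂(wilsonMeasure (d := 3) (L := L) (fundamentalRep (Fin 2)) β')|} ≤
      2 * Real.exp 1 * Real.exp (-((1 - 12 * |β'|) * T * ε ^ 2 / (4 * σ ^ 2 + 4 * ε))) := by
  classical
  haveI : IsProbabilityMeasure (wilsonMeasure (d := 3) (L := L) (fundamentalRep (Fin 2)) β') :=
    isProbabilityMeasure_wilsonMeasure (d := 3) (L := L) (fundamentalRep (Fin 2)) (continuous_fundamentalRep (Fin 2)) β'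
  have hplus := coldStart_timeAverage_tail_le_bernstein_uniform_of_measurable L β' hβ z hW hU0 hU hG hG1 hσ hσ2 t₀ u ht₀ hT hε
  have hnegm : ∫ y, -G y ∂(wilsonMeasure (d := 3) (L := L) (fundamentalRep (Fin 2)) β') = -∫ y, G y ∂(wilsonMeasure (d := 3) (L := L) (fundamentalRep (Fin 2)) β') := integral_neg _
  have hσ2' : ∫ x, ((-G x) - ∫ y, -G y ∂(wilsonMeasure (d := 3) (L := L) (fundamentalRep (Fin 2)) β')) ^ 2 ∂(wilsonMeasure (d := 3) (L := L) (fundamentalRep (Fin 2)) β') ≤ σ ^ 2 := by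
    rw [hnegm]
    have e : (fun x => ((-G x) - -∫ y, G y ∂(wilsonMeasure (d := 3) (L := L) (fundamentalRep (Fin 2)) β')) ^ 2) = fun x => (G x - ∫ y, G y ∂(wilsonMeasure (d := 3) (L := L) (fundamentalRep (Fin 2)) β')) ^ 2 := funext fun x => by ring
    rw [e]; exact hσ2
  have hminus := coldStart_timeAverage_tail_le_bernstein_uniform_of_measurable L β' hβ z hW hU0 hU (G := fun x => -G x) hG.neg
    (fun x => by rw [abs_neg]; exact hG1 x) hσ hσ2' t₀ u ht₀ hT hε
  simp only [integral_neg] at hminus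
  have hsub : {ω | ε ≤ |T⁻¹ * (∫ r in Ioc 0 T, G (U (2 + t₀ + u + r.toNNReal) ω)) - ∫ y, G y ∂(wilsonMeasure (d := 3) (L := L) (fundamentalRep (Fin 2)) β')|} ⊆
      {ω | ε ≤ T⁻¹ * (∫ r in Ioc 0 T, G (U (2 + t₀ + u + r.toNNReal) ω)) - ∫ y, G y ∂(wilsonMeasure (d := 3) (L := L) (fundamentalRep (Fin 2)) β')} ∪
        {ω | ε ≤ T⁻¹ * (-(∫ r in Ioc 0 T, G (U (2 + t₀ + u + r.toNNReal) ω))) - -(∫ y, G y ∂(wilsonMeasure (d := 3) (L := L) (fundamentalRep (Fin 2)) β'))} := by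
    intro ω hω
    simp only [Set.mem_setOf_eq, Set.mem_union] at hω ⊢
    rcases le_abs'.1 hω with h | h
    · right; linarith
    · left; exact h
  calc P.real {ω | ε ≤ |T⁻¹ * (∫ r in Ioc 0 T, G (U (2 + t₀ + u + r.toNNReal) ω)) - ∫ y, G y ∂(wilsonMeasure (d := 3) (L := L) (fundamentalRep (Fin 2)) β')|}
      ≤ P.real ({ω | ε ≤ T⁻¹ * (∫ r in Ioc 0 T, G (U (2 + t₀ + u + r.toNNReal) ω)) - ∫ y, G y ∂(wilsonMeasure (d := 3) (L := L) (fundamentalRep (Fin 2)) β')} ∪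
          {ω | ε ≤ T⁻¹ * (-(∫ r in Ioc 0 T, G (U (2 + t₀ + u + r.toNNReal) ω))) - -(∫ y, G y ∂(wilsonMeasure (d := 3) (L := L) (fundamentalRep (Fin 2)) β'))}) := measureReal_mono hsub
    _ ≤ P.real {ω | ε ≤ T⁻¹ * (∫ r in Ioc 0 T, G (U (2 + t₀ + u + r.toNNReal) ω)) - ∫ y, G y ∂(wilsonMeasure (d := 3) (L := L) (fundamentalRep (Fin 2)) β')} +
          P.real {ω | ε ≤ T⁻¹ * (-(∫ r in Ioc 0 T, G (U (2 + t₀ + u + r.toNNReal) ω))) - -(∫ y, G y ∂(wilsonMeasure (d := 3) (L := L) (fundamentalRep (Fin 2)) β'))} := measureReal_union_le _ _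
    _ ≤ Real.exp 1 * Real.exp (-((1 - 12 * |β'|) * T * ε ^ 2 / (4 * σ ^ 2 + 4 * ε))) +
          Real.exp 1 * Real.exp (-((1 - 12 * |β'|) * T * ε ^ 2 / (4 * σ ^ 2 + 4 * ε))) := add_le_add hplus hminus
    _ = 2 * Real.exp 1 * Real.exp (-((1 - 12 * |β'|) * T * ε ^ 2 / (4 * σ ^ 2 + 4 * ε))) := by ring

/-! ## §3. Occupation times -/

/-- ★★★ **VOLUME-FREE EXPONENTIAL CONCENTRATION OF OCCUPATION TIMES of the cold-start SZZ sampler at the Gibbs probabilities, `|β'| < 1/12`,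
every realisation.**  For every `L`, `|β'| < 1/12` (`λ := 1 − 12|β'|`), every deterministic start, EVERY strong solution `U` on ANY filtered
probability space, EVERY measurable set `A` of configurations with `μ_{β'}(A)(1 − μ_{β'}(A)) ≤ σ²` (`σ > 0`), all `t₀, u` with `log B ≤ 2λt₀`,
every `T > 0` and `ε > 0`:

  `P[ |T⁻¹ ∫_{(0,T]} 𝟙_A(U_{2+t₀+u+r}) dr − μ_{β'}(A)| ≥ ε ] ≤ 2e · exp(−λ·T·ε² / (4σ² + 4ε))`

— the fraction of the time window `(a, a+T]` that one cold-start trajectory spends in `A` is within `ε` of the Gibbs probability of `A` except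
with exponentially small probability, rate `λTε²/(4μ(A)(1 − μ(A)) + 4ε)`, NO dependence on `L` (Lezaud's Chernoff bound for occupation
measures). [cite: Lezaud2001, Theorem 1.1 and Remark 1.2] -/
theorem coldStart_occupationTime_deviation_le_uniform (L : ℕ) [NeZero L] (β' : ℝ) (hβ : |β'| < 1 / 12)
    (z : GaugeConfig 3 L (Matrix.specialUnitaryGroup (Fin 2) ℂ))
    {Ω : Type} [MeasurableSpace Ω] {P : Measure Ω} [IsProbabilityMeasure P]
    {W : ℝ≥0 → Ω → (Edge 3 L × NoiseIdx 2 → ℝ)} (hW : IsFlatBrownian W P)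
    {U : ℝ≥0 → Ω → GaugeConfig 3 L (Matrix.specialUnitaryGroup (Fin 2) ℂ)} (hU0 : ∀ ω, U 0 ω = z)
    (hU : (latticeLangevinDynamics (fundamentalLatticeRep 2) β').IsSolution (fundamentalRep (Fin 2)) hW.natFiltration P W U)
    {A : Set (GaugeConfig 3 L (Matrix.specialUnitaryGroup (Fin 2) ℂ))} (hA : MeasurableSet A) {σ : ℝ} (hσ : 0 < σ)
    (hσ2 : ((wilsonMeasure (d := 3) (L := L) (fundamentalRep (Fin 2)) β')).real A * (1 - ((wilsonMeasure (d := 3) (L := L) (fundamentalRep (Fin 2)) β')).real A) ≤ σ ^ 2)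
    (t₀ u : ℝ≥0)
    (ht₀ : Real.log (96 * |β'| * (Fintype.card (Edge 3 L) : ℝ) + 10 * |β'| * (Fintype.card (Plaquette 3 L) : ℝ) + Real.log 2 +
      (Fintype.card (Edge 3 L) : ℝ) * Real.log (3 / 2)) ≤ 2 * (1 - 12 * |β'|) * t₀)
    {T : ℝ} (hT : 0 < T) {ε : ℝ} (hε : 0 < ε) :
    P.real {ω | ε ≤ |T⁻¹ * (∫ r in Ioc 0 T, A.indicator (fun _ => (1 : ℝ)) (U (2 + t₀ + u + r.toNNReal) ω)) - ((wilsonMeasure (d := 3) (L := L) (fundamentalRep (Fin 2)) β')).real A|} ≤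
      2 * Real.exp 1 * Real.exp (-((1 - 12 * |β'|) * T * ε ^ 2 / (4 * σ ^ 2 + 4 * ε))) := by
  classical
  haveI : IsProbabilityMeasure (wilsonMeasure (d := 3) (L := L) (fundamentalRep (Fin 2)) β') :=
    isProbabilityMeasure_wilsonMeasure (d := 3) (L := L) (fundamentalRep (Fin 2)) (continuous_fundamentalRep (Fin 2)) β'
  have hGm : Measurable (A.indicator fun _ => (1 : ℝ)) := measurable_const.indicator hA
  have hG1 : ∀ x, |A.indicator (fun _ => (1 : ℝ)) x| ≤ 1 := fun x => by
    by_cases hx : x ∈ A <;> simp [Set.indicator, hx]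
  have hmean : ∫ y, A.indicator (fun _ => (1 : ℝ)) y ∂(wilsonMeasure (d := 3) (L := L) (fundamentalRep (Fin 2)) β') = ((wilsonMeasure (d := 3) (L := L) (fundamentalRep (Fin 2)) β')).real A := by
    rw [integral_indicator hA, setIntegral_const, smul_eq_mul, mul_one]
  have hvar : ∫ x, (A.indicator (fun _ => (1 : ℝ)) x - ∫ y, A.indicator (fun _ => (1 : ℝ)) y ∂(wilsonMeasure (d := 3) (L := L) (fundamentalRep (Fin 2)) β')) ^ 2 ∂(wilsonMeasure (d := 3) (L := L) (fundamentalRep (Fin 2)) β') ≤ σ ^ 2 := by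
    rw [hmean]
    set p : ℝ := ((wilsonMeasure (d := 3) (L := L) (fundamentalRep (Fin 2)) β')).real A with hp
    have hfun : (fun x => (A.indicator (fun _ => (1 : ℝ)) x - p) ^ 2) = fun x => (1 - 2 * p) * A.indicator (fun _ => (1 : ℝ)) x + p ^ 2 := by
      funext x
      by_cases hx : x ∈ A <;> (simp [Set.indicator, hx]; try ring)
    rw [hfun, integral_add ((FeynmanKac.integrable_of_measurable_of_abs_le _ hGm hG1).const_mul _) (integrable_const _), integral_const_mul,
      hmean, integral_const, probReal_univ, one_smul]
    nlinarith [hσ2]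
  have h := coldStart_timeAverage_deviation_le_bernstein_uniform_of_measurable L β' hβ z hW hU0 hU hGm hG1 hσ hvar t₀ u ht₀ hT hε
  rw [hmean] at h
  exact h

end Summit.QuantumFields.YangMills.Theorems.ColdStartUniversality

end
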